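import Literature.NumberTheory.LFunctions.ZetaZerosShortIntervalsGG

/-!
# Under RH the distinct ordinates of the zeros of `ζ` have superlinear counting function

Helper file for item stmt-RiemannHypothesis-1043 (`StrictUnderRH`, route WeilWindowFlow). From two
PROVED tree theorems,

* the Riemann–von Mangoldt formula `N(T) = (T/2π) log(T/2π) − T/2π + O(log T)`
  (`Literature.NumberTheory.LFunctions.riemann_von_mangoldt_holds`, Titchmarsh Thm. 9.4), and
* the Goldston–Gonek bound under RH
  `N(t+h) − N(t−h) ≤ (h/π) log(t/2π) + log t/(2 log log t) + (1/2+ε) log t · log₃ t/(log₂ t)²`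
  (`Literature.NumberTheory.LFunctions.zetaZeroCount_short_interval_GG_of_RH`, Balazard–de Roton
  2008 Prop. 16), which bounds the multiplicity of a zero at height `γ` by `δ log γ` for every
  `δ > 0` and `γ ≥ γ₀(δ)`,

we deduce that under RH the number of DISTINCT ordinates `0 < γ ≤ T` of zeros `ζ(1/2 + iγ) = 0`
exceeds `A · T` for every slope `A`, for suitable arbitrarily large `T`
(`exists_card_ordinates_ge`). This is the number-theoretic half of the uniqueness-set argument for
`StrictUnderRH` (the other half is Jensen's inequality for the transform of a ground state).

No definitions, no named facts.
-/

-- `Summit.RiemannHypothesis.RiemannHypothesis.…` repeats a namespace component by design (D-0017 layout).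
set_option linter.dupNamespace false

noncomputable section

open Complex Filter Set
open scoped Real Topology

namespace Summit.RiemannHypothesis.RiemannHypothesis.Theorems.WeilWindowFlowStrictUnderRH

open Literature.NumberTheory.LFunctions

/-! ## Multiplicity of a zero versus the counting function -/

/-- The multiplicity of a zero `ρ` of `ζ` with `Im ρ > 0` is at most `N(Im ρ + h) − N(Im ρ − h)`
for every `h > 0` (`N(v) − N(u) = ∑_{box v ∖ box u} m`, all terms non-negative). [folklore] -/
theorem zeroOrder_le_zetaZeroCount_sub {ρ : ℂ} (hζ : riemannZeta ρ = 0) (him : 0 < ρ.im)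
    {h : ℝ} (hh : 0 < h) :
    (riemannZetaZeroOrder ρ : ℤ) ≤ (zetaZeroCount (ρ.im + h) : ℤ) - zetaZeroCount (ρ.im - h) := by
  have hre1 : ρ.re < 1 := by
    by_contra h1
    exact riemannZeta_ne_zero_of_one_le_re (not_lt.1 h1) hζ
  have hre0 : 0 ≤ ρ.re := by
    by_contra h0
    push Not at h0
    -- zeros with `Re ρ < 0` are trivial zeros, which are real
    have hmem : ρ ∈ ZetaZeros.riemannZetaNontrivialZeros := by
      refine ⟨hζ, ?_⟩
      rintro ⟨n, rfl⟩
      simp at him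
    have := mem_riemannZetaNontrivialZeros_iff_holds.1 hmem
    linarith [this.2.1]
  rw [Montgomery.zetaZeroCount_sub_eq_finsum (by linarith : ρ.im - h ≤ ρ.im + h)]
  have hfin : (zetaZeroBox 0 (ρ.im + h) \ zetaZeroBox 0 (ρ.im - h)).Finite :=
    (zetaZeroBox_finite 0 _).subset Set.sdiff_subset
  rw [finsum_mem_eq_finite_toFinset_sum _ hfin]
  refine Finset.single_le_sum (fun ρ' hρ' ↦ ?_) ?_
  · rw [Set.Finite.mem_toFinset] at hρ'
    exact riemannZetaZeroOrder_nonneg_of_mem_zetaZeroBox hρ'.1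
  · rw [Set.Finite.mem_toFinset]
    refine ⟨⟨hζ, hre0, hre1.le, him, by linarith⟩, ?_⟩
    rintro ⟨-, -, -, -, h5⟩
    linarith

/-- The multiplicity of a zero `ρ` of `ζ` with `Im ρ > 0` is at most `N(Im ρ + 1)`. [folklore] -/
theorem zeroOrder_le_zetaZeroCount_add_one {ρ : ℂ} (hζ : riemannZeta ρ = 0) (him : 0 < ρ.im) :
    (riemannZetaZeroOrder ρ : ℝ) ≤ zetaZeroCount (ρ.im + 1) := by
  have h := zeroOrder_le_zetaZeroCount_sub hζ him one_pos
  have h' : (riemannZetaZeroOrder ρ : ℤ) ≤ (zetaZeroCount (ρ.im + 1) : ℤ) := by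
    have : (0 : ℤ) ≤ zetaZeroCount (ρ.im - 1) := by positivity
    linarith
  exact_mod_cast h'

/-! ## Goldston–Gonek: multiplicities are `o(log γ)` under RH -/

/-- **Multiplicity bound under RH (Goldston–Gonek / Littlewood):** for every `δ > 0` there are
`C` and `T₀` such that for `T ≥ T₀` every zero `ρ` of `ζ` with `0 < Im ρ ≤ T` has multiplicity
`m(ρ) ≤ δ log T + C`. From `zetaZeroCount_short_interval_GG_of_RH` (Balazard–de Roton 2008,
Prop. 16) with `h = min 1 (πδ/2)`: for `γ` beyond `exp (exp (4/δ))` the three terms are each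
`O(δ log γ)`; the finitely many lower zeros have `m(ρ) ≤ N(γ + 1) ≤ N(T₀ + 1) =: C`.
[cite: BalazardDeRoton2008, Prop. 16] -/
theorem exists_zeroOrder_le_mul_log (hRH : _root_.RiemannHypothesis) {δ : ℝ} (hδ : 0 < δ) :
    ∃ C T₀ : ℝ, 0 ≤ C ∧ 1 ≤ T₀ ∧ ∀ T : ℝ, T₀ ≤ T → ∀ ρ ∈ zetaZeroBox 0 T,
      (riemannZetaZeroOrder ρ : ℝ) ≤ δ * Real.log T + C := by
  obtain ⟨T₁, hT₁⟩ := zetaZeroCount_short_interval_GG_of_RH hRH one_pos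
  -- thresholds
  set L : ℝ := max 1 (4 / δ) with hL
  set T₄ : ℝ := max (max T₁ (2 * π)) (Real.exp (Real.exp L)) with hT₄
  have hT₄1 : 2 * π ≤ T₄ := (le_max_right _ _).trans (le_max_left _ _)
  have hT₄T₁ : T₁ ≤ T₄ := (le_max_left _ _).trans (le_max_left _ _)
  have hT₄e : Real.exp (Real.exp L) ≤ T₄ := le_max_right _ _
  have hπ3 : 3 < π := Real.pi_gt_three
  have hT₄pos : 0 < T₄ := by linarith
  set h : ℝ := min 1 (π * δ / 2) with hh
  have hh0 : 0 < h := lt_min one_pos (by positivity)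
  have hh1 : h ≤ 1 := min_le_left _ _
  have hhδ : h ≤ π * δ / 2 := min_le_right _ _
  refine ⟨(zetaZeroCount (T₄ + 1) : ℝ), T₄, by positivity, by linarith, fun T hT ρ hρ ↦ ?_⟩
  obtain ⟨hζ, -, -, him, hγT⟩ := hρ
  have hT0 : 0 < T := hT₄pos.trans_le hT
  have hlogT : 0 ≤ Real.log T := Real.log_nonneg (by linarith)
  by_cases hγ : ρ.im < T₄
  · -- low zeros: multiplicity at most `N(T₄ + 1)`
    have h1 : (riemannZetaZeroOrder ρ : ℝ) ≤ zetaZeroCount (ρ.im + 1) :=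
      zeroOrder_le_zetaZeroCount_add_one hζ him
    have h2 : (zetaZeroCount (ρ.im + 1) : ℝ) ≤ zetaZeroCount (T₄ + 1) := by
      exact_mod_cast zetaZeroCount_mono (by linarith)
    nlinarith [mul_nonneg hδ.le hlogT]
  · push Not at hγ
    set γ := ρ.im with hγdef
    have hγpos : 0 < γ := him
    have hγT₁ : T₁ ≤ γ := hT₄T₁.trans hγ
    -- the Goldston–Gonek bound at `t = γ`
    have hGG := hT₁ γ hγT₁ h hh0 hh1
    have hm : (riemannZetaZeroOrder ρ : ℝ) ≤ (zetaZeroCount (γ + h) : ℝ) - zetaZeroCount (γ - h) := by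
      have := zeroOrder_le_zetaZeroCount_sub hζ him hh0
      exact_mod_cast this
    -- sizes of the logarithms at `γ ≥ exp (exp L)`
    have hγe : Real.exp (Real.exp L) ≤ γ := hT₄e.trans hγ
    have hL1 : 1 ≤ L := le_max_left _ _
    have hLδ : 4 / δ ≤ L := le_max_right _ _
    have hlogγ : Real.exp L ≤ Real.log γ := by
      rw [← Real.log_exp (Real.exp L)]
      exact Real.log_le_log (Real.exp_pos _) hγe
    have hlogγpos : 0 < Real.log γ := (Real.exp_pos _).trans_le hlogγ
    have hLL : L ≤ Real.log (Real.log γ) := by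
      rw [← Real.log_exp L]
      exact Real.log_le_log (Real.exp_pos _) hlogγ
    have hLLpos : 0 < Real.log (Real.log γ) := by linarith
    have hLLδ : 4 / δ ≤ Real.log (Real.log γ) := hLδ.trans hLL
    -- (1) `(h/π) log(γ/2π) ≤ (δ/2) log γ`
    have h2π : 1 ≤ 2 * π := by linarith
    have hlog2π : Real.log (γ / (2 * π)) ≤ Real.log γ := by
      refine Real.log_le_log (by positivity) ?_
      rw [div_le_iff₀ (by positivity)]
      nlinarith
    have hterm1 : h / π * Real.log (γ / (2 * π)) ≤ δ / 2 * Real.log γ := by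
      have hπ0 : 0 < π := by linarith
      have hhπ : h / π ≤ δ / 2 := by
        rw [div_le_iff₀ hπ0]; linarith
      calc h / π * Real.log (γ / (2 * π)) ≤ h / π * Real.log γ :=
            mul_le_mul_of_nonneg_left hlog2π (by positivity)
        _ ≤ δ / 2 * Real.log γ := mul_le_mul_of_nonneg_right hhπ hlogγpos.le
    -- (2) `log γ/(2 log log γ) ≤ (δ/8) log γ`
    have hterm2 : Real.log γ / (2 * Real.log (Real.log γ)) ≤ δ / 8 * Real.log γ := by
      rw [div_le_iff₀ (by positivity)]
      have : (1 : ℝ) ≤ δ / 8 * (2 * Real.log (Real.log γ)) := by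
        have h4 : 4 ≤ δ * Real.log (Real.log γ) := by
          have := mul_le_mul_of_nonneg_left hLLδ hδ.le
          rwa [mul_div_cancel₀ _ hδ.ne'] at this
        linarith
      nlinarith
    -- (3) `(3/2) log γ · log₃ γ/(log₂ γ)² ≤ (3δ/8) log γ`
    have hterm3 : (1 / 2 + 1) * Real.log γ * Real.log (Real.log (Real.log γ)) /
        Real.log (Real.log γ) ^ 2 ≤ 3 * δ / 8 * Real.log γ := by
      have hLLL : Real.log (Real.log (Real.log γ)) ≤ Real.log (Real.log γ) :=
        Real.log_le_self hLLpos.le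
      rw [div_le_iff₀ (by positivity)]
      have h4 : 4 ≤ δ * Real.log (Real.log γ) := by
        have := mul_le_mul_of_nonneg_left hLLδ hδ.le
        rwa [mul_div_cancel₀ _ hδ.ne'] at this
      have hA : (1 / 2 + 1) * Real.log γ * Real.log (Real.log (Real.log γ)) ≤
          (3 / 2) * Real.log γ * Real.log (Real.log γ) := by
        have := mul_le_mul_of_nonneg_left hLLL (by positivity : (0 : ℝ) ≤ 3 / 2 * Real.log γ)
        linarith
      have hB : (3 / 2) * Real.log γ * Real.log (Real.log γ) ≤
          3 * δ / 8 * Real.log γ * Real.log (Real.log γ) ^ 2 := by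
        have : (3 / 2 : ℝ) * Real.log γ * Real.log (Real.log γ) * 4 ≤
            (3 / 2) * Real.log γ * Real.log (Real.log γ) * (δ * Real.log (Real.log γ)) :=
          mul_le_mul_of_nonneg_left h4 (by positivity)
        nlinarith
      linarith
    -- assemble: `m(ρ) ≤ δ log γ ≤ δ log T`
    have hlogγT : Real.log γ ≤ Real.log T := Real.log_le_log hγpos hγT
    have hmain : (riemannZetaZeroOrder ρ : ℝ) ≤ δ * Real.log γ := by linarith
    have hC : (0 : ℝ) ≤ zetaZeroCount (T₄ + 1) := by positivity
    nlinarith [mul_le_mul_of_nonneg_left hlogγT hδ.le]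

/-! ## Riemann–von Mangoldt: `N(T) ≥ T log T / 4π` eventually -/

/-- From the Riemann–von Mangoldt formula: `T log T/(4π) ≤ N(T)` for all large `T`.
[cite: Titchmarsh1986, Thm. 9.4] -/
theorem eventually_mul_log_le_zetaZeroCount :
    ∀ᶠ T : ℝ in atTop, T * Real.log T / (4 * π) ≤ (zetaZeroCount T : ℝ) := by
  obtain ⟨c, hc⟩ := Asymptotics.isBigO_iff.1 riemann_von_mangoldt_holds
  have hπ3 : 3 < π := Real.pi_gt_three
  have hπ0 : 0 < π := by linarith
  filter_upwards [hc, eventually_ge_atTop (1 : ℝ), eventually_ge_atTop (8 * π * |c|),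
    eventually_ge_atTop (Real.exp (4 * (Real.log (2 * π) + 1)))] with T hT hT1 hTc hTe
  rw [Real.norm_eq_abs, Real.norm_eq_abs, abs_of_nonneg (Real.log_nonneg hT1)] at hT
  have hlogT : 0 ≤ Real.log T := Real.log_nonneg hT1
  have hlog2π : 0 < Real.log (2 * π) := Real.log_pos (by linarith)
  have hlogTe : 4 * (Real.log (2 * π) + 1) ≤ Real.log T := by
    rw [← Real.log_exp (4 * (Real.log (2 * π) + 1))]
    exact Real.log_le_log (Real.exp_pos _) hTe
  have habs := (abs_le.1 hT).1
  have hsplit : Real.log (T / (2 * π)) = Real.log T - Real.log (2 * π) :=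
    Real.log_div (by linarith) (by positivity)
  rw [hsplit] at habs
  -- `N(T) ≥ (T/2π)(log T − log 2π − 1) − |c| log T ≥ T log T/(4π)`
  have hc' : c * Real.log T ≤ |c| * Real.log T := mul_le_mul_of_nonneg_right (le_abs_self c) hlogT
  have h1 : |c| * Real.log T ≤ T / (8 * π) * Real.log T := by
    refine mul_le_mul_of_nonneg_right ?_ hlogT
    rw [le_div_iff₀ (by positivity)]
    linarith
  have h2 : T / (2 * π) * (Real.log (2 * π) + 1) ≤ T / (8 * π) * Real.log T := by
    have : T / (2 * π) * (Real.log (2 * π) + 1) = T / (8 * π) * (4 * (Real.log (2 * π) + 1)) := by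
      field_simp; ring
    rw [this]
    exact mul_le_mul_of_nonneg_left hlogTe (by positivity)
  have h3 : T * Real.log T / (4 * π) =
      T / (2 * π) * Real.log T - T / (8 * π) * Real.log T - T / (8 * π) * Real.log T := by
    field_simp; ring
  rw [h3]
  nlinarith

/-! ## Distinct ordinates -/

/-- Under RH a zero of `ζ` with positive imaginary part lies on the critical line:
`ρ = 1/2 + i Im ρ`. [folklore] -/
theorem eq_half_add_of_RH (hRH : _root_.RiemannHypothesis) {ρ : ℂ} (hζ : riemannZeta ρ = 0)
    (him : 0 < ρ.im) : ρ = 1 / 2 + (ρ.im : ℂ) * I := by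
  have hne : ρ ≠ 1 := by
    rintro rfl
    simp at him
  have hre : ρ.re = 1 / 2 := by
    refine hRH ρ hζ ?_ hne
    rintro ⟨n, rfl⟩
    simp at him
  apply Complex.ext <;> simp [hre]

/-- **Under RH the distinct ordinates have superlinear counting function**: for every slope `A`
and threshold `T₁` there are `T ≥ T₁` and a finite set `S` of distinct reals `γ` with
`0 < γ ≤ T`, `ζ(1/2 + iγ) = 0` and `#S ≥ A · T`. Proof: `N(T) = ∑_{box T} m(ρ) ≤ #box · (δ log T + C)`
(multiplicity bound with `δ = 1/(8πA)`), `N(T) ≥ T log T/(4π)` (Riemann–von Mangoldt), and under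
RH `ρ ↦ Im ρ` is injective on the box. [folklore] -/
theorem exists_card_ordinates_ge (hRH : _root_.RiemannHypothesis) (A T₁ : ℝ) :
    ∃ T : ℝ, T₁ ≤ T ∧ ∃ S : Finset ℝ,
      (∀ γ ∈ S, 0 < γ ∧ γ ≤ T ∧ riemannZeta (1 / 2 + (γ : ℂ) * I) = 0) ∧ A * T ≤ S.card := by
  classical
  have hπ3 : 3 < π := Real.pi_gt_three
  set A' : ℝ := max A 1 with hA'
  have hA'1 : 1 ≤ A' := le_max_right _ _
  have hA'0 : 0 < A' := by linarith
  set δ : ℝ := 1 / (8 * π * A') with hδdef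
  have hδ : 0 < δ := by positivity
  obtain ⟨C, T₀, hC0, hT₀1, hmult⟩ := exists_zeroOrder_le_mul_log hRH hδ
  obtain ⟨T₂, hT₂⟩ := Filter.eventually_atTop.1 eventually_mul_log_le_zetaZeroCount
  set T : ℝ := max (max T₁ T₀) (max T₂ (Real.exp (8 * π * A' * C + 1))) with hTdef
  have hTT₁ : T₁ ≤ T := (le_max_left _ _).trans (le_max_left _ _)
  have hTT₀ : T₀ ≤ T := (le_max_right _ _).trans (le_max_left _ _)
  have hTT₂ : T₂ ≤ T := (le_max_left _ _).trans (le_max_right _ _)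
  have hTe : Real.exp (8 * π * A' * C + 1) ≤ T := (le_max_right _ _).trans (le_max_right _ _)
  have hT1 : 1 ≤ T := hT₀1.trans hTT₀
  have hT0 : 0 < T := by linarith
  have hlogT : 8 * π * A' * C + 1 ≤ Real.log T := by
    rw [← Real.log_exp (8 * π * A' * C + 1)]
    exact Real.log_le_log (Real.exp_pos _) hTe
  have hlogTpos : 0 < Real.log T := by
    have : 0 ≤ 8 * π * A' * C := by positivity
    linarith
  -- the box of zeros up to height `T` and its set of ordinates
  have hfin : (zetaZeroBox 0 T).Finite := zetaZeroBox_finite 0 T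
  set B : Finset ℂ := hfin.toFinset with hB
  set S : Finset ℝ := B.image Complex.im with hS
  have hmemB : ∀ ρ ∈ B, ρ ∈ zetaZeroBox 0 T := fun ρ hρ ↦ (Set.Finite.mem_toFinset hfin).1 hρ
  have hinj : Set.InjOn Complex.im (B : Set ℂ) := by
    intro ρ hρ ρ' hρ' heq
    obtain ⟨hζ, -, -, him, -⟩ := hmemB ρ hρ
    obtain ⟨hζ', -, -, him', -⟩ := hmemB ρ' hρ'
    rw [eq_half_add_of_RH hRH hζ him, eq_half_add_of_RH hRH hζ' him', heq]
  have hcard : S.card = B.card := Finset.card_image_of_injOn hinj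
  refine ⟨T, hTT₁, S, fun γ hγ ↦ ?_, ?_⟩
  · obtain ⟨ρ, hρ, rfl⟩ := Finset.mem_image.1 hγ
    obtain ⟨hζ, -, -, him, hle⟩ := hmemB ρ hρ
    refine ⟨him, hle, ?_⟩
    rwa [← eq_half_add_of_RH hRH hζ him]
  · -- `N(T) = ∑_{ρ ∈ B} m(ρ) ≤ #B (δ log T + C)`
    have hN : (zetaZeroCount T : ℝ) = ∑ ρ ∈ B, (riemannZetaZeroOrder ρ : ℝ) := by
      have h := zetaZeroCount_eq_finsum T
      rw [finsum_mem_eq_finite_toFinset_sum _ hfin] at h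
      have h' : ((zetaZeroCount T : ℤ) : ℝ) = ((∑ ρ ∈ B, riemannZetaZeroOrder ρ : ℤ) : ℝ) := by
        rw [h]
      push_cast at h'
      exact h'
    have hsum : (zetaZeroCount T : ℝ) ≤ B.card * (δ * Real.log T + C) := by
      rw [hN]
      calc ∑ ρ ∈ B, (riemannZetaZeroOrder ρ : ℝ) ≤ ∑ _ρ ∈ B, (δ * Real.log T + C) :=
            Finset.sum_le_sum fun ρ hρ ↦ hmult T hTT₀ ρ (hmemB ρ hρ)
        _ = B.card * (δ * Real.log T + C) := by rw [Finset.sum_const, nsmul_eq_mul]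
    have hRvM : T * Real.log T / (4 * π) ≤ (zetaZeroCount T : ℝ) := hT₂ T hTT₂
    -- `δ log T + C ≤ log T/(4π A')`
    have hden : δ * Real.log T + C ≤ Real.log T / (4 * π * A') := by
      rw [hδdef]
      have hC' : C ≤ Real.log T / (8 * π * A') := by
        rw [le_div_iff₀ (by positivity)]
        nlinarith
      have : 1 / (8 * π * A') * Real.log T + Real.log T / (8 * π * A') = Real.log T / (4 * π * A') := by
        field_simp; ring
      linarith
    have h5 : (B.card : ℝ) * (δ * Real.log T + C) ≤ (B.card : ℝ) * (Real.log T / (4 * π * A')) :=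
      mul_le_mul_of_nonneg_left hden (Nat.cast_nonneg _)
    have hkey : T * Real.log T / (4 * π) ≤ B.card * (Real.log T / (4 * π * A')) :=
      hRvM.trans (hsum.trans h5)
    have hkey' : A' * T * (Real.log T / (4 * π * A')) ≤ B.card * (Real.log T / (4 * π * A')) := by
      have : A' * T * (Real.log T / (4 * π * A')) = T * Real.log T / (4 * π) := by
        calc A' * T * (Real.log T / (4 * π * A'))
            = T * Real.log T / (4 * π) * (A' / A') := by ring
          _ = T * Real.log T / (4 * π) := by rw [div_self hA'0.ne', mul_one]
      rw [this]; exact hkey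
    have hpos : 0 < Real.log T / (4 * π * A') := by positivity
    have hAT : A' * T ≤ B.card := le_of_mul_le_mul_right hkey' hpos
    rw [hcard]
    calc A * T ≤ A' * T := mul_le_mul_of_nonneg_right (le_max_left _ _) hT0.le
      _ ≤ B.card := hAT

end Summit.RiemannHypothesis.RiemannHypothesis.Theorems.WeilWindowFlowStrictUnderRH

end
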